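import Summits.QuantumFields.YangMills.Theorems.BalabanUVNodesK0Stub1Eq158FlatOpsMatrixFields
import Summits.QuantumFields.YangMills.Theorems.BalabanUVNodesK0Stub1FlatPropagatorsExistAtRecord
import Summits.QuantumFields.YangMills.Theorems.UnitScaleTiltProp8ChartHInvComb
import HarnessLib

/-!
# K0⁷ STUB 1 (`stub_prop8StepCoP13`), sub-target S4a, DICTIONARY: **THE ONE-LEVEL MEMBER `twoScale k _ ∅` OF THE MULTI-LEVEL CONSTRAINT `Q_V` IS THE ENTRYWISE
# STRAIGHT-LINE AVERAGE `Q_k = LatticeFieldCalculus.bondAvgIter k`** — so the tangent-space hypothesis «`Q_Vδ = 0`» of this seat's `…Eq158FlatOpsMatrixFields`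
# (print's (156)–(157) «`L^jηQ_jA′ = B` on `Λ′_j`» for an arbitrary nested family) reads, for the one-level family, as the «`Q_kX = 0`» of this seat's
# `…FlatHessian{Landau,RGauge}CoercivityAtRecord` (files 1–2 of g2), on the SAME matrix-valued bond fields

Cell `pub-ymgap`, width seat `pub-ymgap-k0-s1-w1` g2 (INTENT-5).  `--kind proof --supports stmt-QuantumFields-20541 --as helper`; count-neutral.  [15] = [Balaban1985Variational];
[B5] = [Balaban1984PropagatorsI]; [B6] = [Balaban1984PropagatorsII].

WHY.  g2's files on S1's carrier (p593232, p593935) state their tangent-space hypothesis as `bondAvgIter k X = 0` ENTRYWISE on the matrix field `X` ([B5] (1.18)); g2's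
matrix-carrier file (p595460) states it as `Q_Vδ = 0` for the componentwise extension `Q_V` of lit-balaban's multi-level `QE D` ([B6] (2.20)) of an arbitrary nested family
`D`.  For the ONE-LEVEL family `D = twoScale k _ ∅` (all `Ω_i = T_η`, `Λ′ = ∅`: constraints = all bonds of `T^{(k)}` — [B6] (2.90) at `Λ′ = ∅`; UST
`Prop7FlatSliceRegularity.QE_twoScale_empty_eq_zero_iff`: `QE (twoScale k _ ∅) x = 0 ↔ bondAvgIter k x = 0` on real fields) the two are THE SAME condition; this file
records it for the matrix extension, so that the one-level instance of p595460's (127) ⟹ (158) is stated with the hypothesis block of files 1–2.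

WHAT IS PROVED (sorry-free; no definition; axioms standard).
* §1 `QE_twoScale_empty_bondIdxOfEmpty` (`QE (twoScale k _ ∅) x` at the index of the level-`k` bond `c` IS `(Q_k x)(c)`, `rfl`), ★ `QV_twoScale_empty_apply` (the matrix
  extension `Q_V` of `QE (twoScale k _ ∅)` at that index IS `bondAvgIter k A c` ENTRYWISE on `A : PBond P 0 → M_N(ℂ)`), ★★ `QV_twoScale_empty_eq_zero_iff`
  (`Q_VA = 0 ↔ ∀ c, (Q_kA)(c) = 0`).
* §2 ★ `eq158_flatOps_oneLevel` — p595460's `eq158_flatOps_matrixFields` at `D = twoScale k _ ∅` with the test class written «skew `δ`, `Q_kδ = 0`» (files 1–2's form);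
  `eq158_flatOps_oneLevel_T4` at `Site (F.P K) 0`, `k + 1 ≤ m + K`.
HONEST SCOPE.  Bookkeeping between two typed editions of the same linear constraint; ONE level, whole torus, FLAT; the identification of `bondAvgIter k` (straight-line
contours, [B5] (1.11)∕(1.18)) with the linearisation at background `1` of the record's (0.4) averaging (dag-n07-w1 INTENT-5 `Node00/LinearisedAveragingAtBackground`, `dIterL`)
is NOT here; nothing of Bałaban asserted; `stub_prop8StepCoP13` ∕ K0⁷ NOT closed; N07 NOT discharged; counts unmoved (28∕28 · 5∕27); one finite 𝕋⁴ programme at fixed ε —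
R4 closes the conditional finite-𝕋⁴ rung `BalabanLadder.UV` only, never the summit; the YM mass gap (Clay) is NOT proved by any of this; nothing continuum ∕ ℝ⁴ ∕ OS.
No `sorry`, no `def`, no `instance`, no `notation`.

References: [B5] (1.11) p.19, (1.18) p.20; [B6] (2.20) p.226, (2.90) p.239; [15] (156)–(158) p.302.
-/

set_option autoImplicit false
noncomputable section
open scoped BigOperators Matrix

namespace Summit.QuantumFields.YangMills.Theorems.K0Stub1OneLevelConstraintDictionary

open Literature.MathematicalPhysics.QuantumFieldTheory.Balaban1983to89
open Literature.MathematicalPhysics.QuantumFieldTheory.Balaban1983to89.T4Continuum (T4Family)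
open Literature.MathematicalPhysics.QuantumFieldTheory.BalabanImbrieJaffe1984to88.BIJ85AxialPropagator411 (BondSpace)
open LatticeFieldCalculus (bondAvgIter)
open B6SectADomainsV1 (Domains)
open B6SectAOperatorsV1 (BondIdx BondIdxSpace QE QsE QE_apply)
open B6SectAVectorModelV1 (deltaAE GE EE)
open B6SectCTwoScaleV1 (twoScale)
open B6SectA (hOp)
open B6GOneLevelV1Bridge (bondIdxOfEmpty bondIdxOfEmpty_bijective)
open Summit.QuantumFields.YangMills.Theorems.K0Stub1Eq158FlatOpsMatrixFields (extension_entry_re extension_entry_im eq158_flatOps_matrixFields)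
open Summit.QuantumFields.YangMills.Theorems.ChartHInv (bondAvgIter_comp_apply)
open Summit.QuantumFields.YangMills.Theorems.K0Stub1FlatPropagatorsExistAtRecord (succ_le_m_add_K)

variable {P : Params} {k : ℕ} (hk1 : k + 1 ≤ P.m + P.K) {n : Type*}

/-! ## §1  The one-level member of `Q` and of its matrix extension `Q_V` is `Q_k = bondAvgIter k` -/

/-- `QE (twoScale k _ ∅) x` read at the index of the level-`k` bond `c` is `(Q_k x)(c)` ([B6] (2.20) at the one-level family; `rfl`). [cite: Balaban1984PropagatorsII, (2.20) p.226, (2.90) p.239] -/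
theorem QE_twoScale_empty_bondIdxOfEmpty (x : BondSpace P) (c : PBond P k) :
    QE (twoScale k hk1 (∅ : Finset (Site P (k + 1)))) x (bondIdxOfEmpty hk1 c) = bondAvgIter k (WithLp.ofLp x) c := rfl

open scoped Classical in
/-- ★ **THE MATRIX EXTENSION OF THE ONE-LEVEL `Q` IS `Q_k` ENTRYWISE**: for `Q_V` the componentwise extension of `QE (twoScale k _ ∅)` (kernel formula of p595460) and
`A : PBond P 0 → M_N(ℂ)`, `(Q_VA)(c) = (bondAvgIter k A)(c)` at every level-`k` bond `c` (each of the `2N²` real components: `extension_entry_re∕im` of p595460 and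
UST `ChartHInv.bondAvgIter_comp_apply` at the entry functionals). [cite: Balaban1984PropagatorsI, (1.18) p.20; Balaban1984PropagatorsII, (2.20) p.226] -/
theorem QV_twoScale_empty_apply {QV : (PBond P 0 → Matrix n n ℂ) →ₗ[ℂ] (BondIdx (twoScale k hk1 (∅ : Finset (Site P (k + 1)))) → Matrix n n ℂ)}
    (hQV : ∀ (A : PBond P 0 → Matrix n n ℂ) (t : BondIdx (twoScale k hk1 (∅ : Finset (Site P (k + 1))))),
      QV A t = ∑ j, ((WithLp.ofLp (QE (twoScale k hk1 ∅) (WithLp.toLp 2 (Pi.single j 1))) t : ℝ) : ℂ) • A j)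
    (A : PBond P 0 → Matrix n n ℂ) (c : PBond P k) : QV A (bondIdxOfEmpty hk1 c) = bondAvgIter k A c := by
  -- the plain-function edition of the one-level `Q`
  have hQV' : ∀ (A : PBond P 0 → Matrix n n ℂ) (t : BondIdx (twoScale k hk1 (∅ : Finset (Site P (k + 1))))), QV A t =
      ∑ j, ((((WithLp.linearEquiv 2 ℝ (BondIdx (twoScale k hk1 (∅ : Finset (Site P (k + 1)))) → ℝ)).toLinearMap ∘ₗ QE (twoScale k hk1 ∅) ∘ₗ
        (WithLp.linearEquiv 2 ℝ (PBond P 0 → ℝ)).symm.toLinearMap) (Pi.single j 1) t : ℝ) : ℂ) • A j := fun A t => by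
    simp only [LinearMap.comp_apply, LinearEquiv.coe_coe, WithLp.coe_linearEquiv, WithLp.coe_symm_linearEquiv]; exact hQV A t
  ext i i'
  apply Complex.ext
  · rw [extension_entry_re _ hQV' A (bondIdxOfEmpty hk1 c) i i']
    have h := bondAvgIter_comp_apply (Complex.reLm ∘ₗ Matrix.entryLinearMap ℝ ℂ i i') k A c
    simp only [LinearMap.comp_apply, LinearEquiv.coe_coe, WithLp.coe_linearEquiv, WithLp.coe_symm_linearEquiv] at h ⊢
    exact h
  · rw [extension_entry_im _ hQV' A (bondIdxOfEmpty hk1 c) i i']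
    have h := bondAvgIter_comp_apply (Complex.imLm ∘ₗ Matrix.entryLinearMap ℝ ℂ i i') k A c
    simp only [LinearMap.comp_apply, LinearEquiv.coe_coe, WithLp.coe_linearEquiv, WithLp.coe_symm_linearEquiv] at h ⊢
    exact h

open scoped Classical in
/-- ★★ **`Q_VA = 0 ↔ Q_kA = 0`** for the matrix extension of the one-level `Q` — the tangent-space hypothesis of p595460 at `D = twoScale k _ ∅` IS the hypothesis
«`∀ c, bondAvgIter k A c = 0`» of p593232 ∕ p593935 (every constrained index is a level-`k` bond: `B6GOneLevelV1Bridge.bondIdxOfEmpty_bijective`).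
[cite: Balaban1984PropagatorsII, (2.20) p.226, (2.90) p.239; Balaban1985Variational, (156)–(157) p.302] -/
theorem QV_twoScale_empty_eq_zero_iff {QV : (PBond P 0 → Matrix n n ℂ) →ₗ[ℂ] (BondIdx (twoScale k hk1 (∅ : Finset (Site P (k + 1)))) → Matrix n n ℂ)}
    (hQV : ∀ (A : PBond P 0 → Matrix n n ℂ) (t : BondIdx (twoScale k hk1 (∅ : Finset (Site P (k + 1))))),
      QV A t = ∑ j, ((WithLp.ofLp (QE (twoScale k hk1 ∅) (WithLp.toLp 2 (Pi.single j 1))) t : ℝ) : ℂ) • A j)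
    (A : PBond P 0 → Matrix n n ℂ) : QV A = 0 ↔ ∀ c : PBond P k, bondAvgIter k A c = 0 := by
  constructor
  · intro h c
    rw [← QV_twoScale_empty_apply hk1 hQV A c, h, Pi.zero_apply]
  · intro h
    funext t
    obtain ⟨c, rfl⟩ := (bondIdxOfEmpty_bijective hk1).2 t
    rw [QV_twoScale_empty_apply hk1 hQV A c, h c, Pi.zero_apply]

/-! ## §2  (127) ⟹ (158) with print's flat operators of the ONE-LEVEL family, hypothesis block in the letters of files 1–2 -/

variable [Fintype n] [DecidableEq n]

open scoped Classical in
/-- ★ **(127)∕(128) ⟹ (158) AT ONE LEVEL, WITH THE TEST CLASS «skew `δ`, `Q_kδ = 0`»**: p595460's `eq158_flatOps_matrixFields` at `D = twoScale k _ ∅` (lattice factor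
`c ≠ 0`, weights `> 0`; print's `G̃ = G − HQG`, `H = GQ*(QGQ*)⁻¹` of the one-level family, their componentwise extensions), the tangent space read through §1 as the
entrywise kernel of `Q_k = bondAvgIter k` — the letters of p593232 ∕ p593935. [cite: Balaban1985Variational, (127)–(128) p.297, (158) p.302; Balaban1984PropagatorsI, (1.18) p.20] -/
theorem eq158_flatOps_oneLevel {c : ℝ} (hc : c ≠ 0) {w : BondIdx (twoScale k hk1 (∅ : Finset (Site P (k + 1)))) → ℝ} (hw : ∀ i, 0 < w i)
    {DV GV : (PBond P 0 → Matrix n n ℂ) →ₗ[ℂ] (PBond P 0 → Matrix n n ℂ)}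
    {QV : (PBond P 0 → Matrix n n ℂ) →ₗ[ℂ] (BondIdx (twoScale k hk1 (∅ : Finset (Site P (k + 1)))) → Matrix n n ℂ)}
    {HV : (BondIdx (twoScale k hk1 (∅ : Finset (Site P (k + 1)))) → Matrix n n ℂ) →ₗ[ℂ] (PBond P 0 → Matrix n n ℂ)}
    (hDV : ∀ (A : PBond P 0 → Matrix n n ℂ) (b : PBond P 0),
      DV A b = ∑ j, ((WithLp.ofLp (deltaAE (twoScale k hk1 ∅) c w (WithLp.toLp 2 (Pi.single j 1))) b : ℝ) : ℂ) • A j)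
    (hGV : ∀ (A : PBond P 0 → Matrix n n ℂ) (b : PBond P 0),
      GV A b = ∑ j, ((WithLp.ofLp ((GE (twoScale k hk1 ∅) hc hw - hOp (GE (twoScale k hk1 ∅) hc hw) (QsE (twoScale k hk1 ∅)) (EE (twoScale k hk1 ∅) hc hw) ∘ₗ
        QE (twoScale k hk1 ∅) ∘ₗ GE (twoScale k hk1 ∅) hc hw) (WithLp.toLp 2 (Pi.single j 1))) b : ℝ) : ℂ) • A j)
    (hQV : ∀ (A : PBond P 0 → Matrix n n ℂ) (t : BondIdx (twoScale k hk1 (∅ : Finset (Site P (k + 1))))),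
      QV A t = ∑ j, ((WithLp.ofLp (QE (twoScale k hk1 ∅) (WithLp.toLp 2 (Pi.single j 1))) t : ℝ) : ℂ) • A j)
    (hHV : ∀ (B : BondIdx (twoScale k hk1 (∅ : Finset (Site P (k + 1)))) → Matrix n n ℂ) (b : PBond P 0),
      HV B b = ∑ t, ((WithLp.ofLp (hOp (GE (twoScale k hk1 ∅) hc hw) (QsE (twoScale k hk1 ∅)) (EE (twoScale k hk1 ∅) hc hw)
        (WithLp.toLp 2 (Pi.single t 1))) b : ℝ) : ℂ) • B t)
    (W : (PBond P 0 → Matrix n n ℂ) → (PBond P 0 → Matrix n n ℂ)) {A' : PBond P 0 → Matrix n n ℂ} (hA : ∀ j, (A' j)ᴴ = -A' j)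
    (hW : ∀ j, (W A' j)ᴴ = -(W A' j))
    (h128 : ∀ δ : PBond P 0 → Matrix n n ℂ, (∀ j, (δ j)ᴴ = -δ j) → (∀ c : PBond P k, bondAvgIter k δ c = 0) →
      ∑ j, ((δ j)ᴴ * (DV A' j + W A' j)).trace.re = 0) :
    (A' - HV (QV A')) + GV (W ((A' - HV (QV A')) + HV (QV A'))) = 0 :=
  eq158_flatOps_matrixFields (twoScale k hk1 ∅) hc hw hDV hGV hQV hHV W hA hW
    fun δ hδ hQ => h128 δ hδ ((QV_twoScale_empty_eq_zero_iff hk1 hQV δ).mp hQ)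

open scoped Classical in
/-- ★ **AT THE RECORD's FINE TORUS** `Site (F.P K) 0`, `k + 1 ≤ m + K` averaging levels: the one-level (127) ⟹ (158) with print's flat operators, test class «skew `δ`,
`Q_kδ = 0`». [cite: Balaban1985Variational, (158) p.302; Balaban1987RG1, (0.1) p.251] -/
theorem eq158_flatOps_oneLevel_T4 (F : T4Family) (K k : ℕ) (hk1 : k + 1 ≤ F.m + K) {c : ℝ} (hc : c ≠ 0)
    {w : BondIdx (twoScale k (succ_le_m_add_K F K k hk1) (∅ : Finset (Site (F.P K) (k + 1)))) → ℝ} (hw : ∀ i, 0 < w i)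
    {DV GV : (PBond (F.P K) 0 → Matrix n n ℂ) →ₗ[ℂ] (PBond (F.P K) 0 → Matrix n n ℂ)}
    {QV : (PBond (F.P K) 0 → Matrix n n ℂ) →ₗ[ℂ] (BondIdx (twoScale k (succ_le_m_add_K F K k hk1) (∅ : Finset (Site (F.P K) (k + 1)))) → Matrix n n ℂ)}
    {HV : (BondIdx (twoScale k (succ_le_m_add_K F K k hk1) (∅ : Finset (Site (F.P K) (k + 1)))) → Matrix n n ℂ) →ₗ[ℂ] (PBond (F.P K) 0 → Matrix n n ℂ)}
    (hDV : ∀ (A : PBond (F.P K) 0 → Matrix n n ℂ) (b : PBond (F.P K) 0),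
      DV A b = ∑ j, ((WithLp.ofLp (deltaAE (twoScale k (succ_le_m_add_K F K k hk1) ∅) c w (WithLp.toLp 2 (Pi.single j 1))) b : ℝ) : ℂ) • A j)
    (hGV : ∀ (A : PBond (F.P K) 0 → Matrix n n ℂ) (b : PBond (F.P K) 0),
      GV A b = ∑ j, ((WithLp.ofLp ((GE (twoScale k (succ_le_m_add_K F K k hk1) ∅) hc hw -
        hOp (GE (twoScale k (succ_le_m_add_K F K k hk1) ∅) hc hw) (QsE (twoScale k (succ_le_m_add_K F K k hk1) ∅))
          (EE (twoScale k (succ_le_m_add_K F K k hk1) ∅) hc hw) ∘ₗ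
        QE (twoScale k (succ_le_m_add_K F K k hk1) ∅) ∘ₗ GE (twoScale k (succ_le_m_add_K F K k hk1) ∅) hc hw) (WithLp.toLp 2 (Pi.single j 1))) b : ℝ) : ℂ) • A j)
    (hQV : ∀ (A : PBond (F.P K) 0 → Matrix n n ℂ) (t : BondIdx (twoScale k (succ_le_m_add_K F K k hk1) (∅ : Finset (Site (F.P K) (k + 1))))),
      QV A t = ∑ j, ((WithLp.ofLp (QE (twoScale k (succ_le_m_add_K F K k hk1) ∅) (WithLp.toLp 2 (Pi.single j 1))) t : ℝ) : ℂ) • A j)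
    (hHV : ∀ (B : BondIdx (twoScale k (succ_le_m_add_K F K k hk1) (∅ : Finset (Site (F.P K) (k + 1)))) → Matrix n n ℂ) (b : PBond (F.P K) 0),
      HV B b = ∑ t, ((WithLp.ofLp (hOp (GE (twoScale k (succ_le_m_add_K F K k hk1) ∅) hc hw) (QsE (twoScale k (succ_le_m_add_K F K k hk1) ∅))
        (EE (twoScale k (succ_le_m_add_K F K k hk1) ∅) hc hw) (WithLp.toLp 2 (Pi.single t 1))) b : ℝ) : ℂ) • B t)
    (W : (PBond (F.P K) 0 → Matrix n n ℂ) → (PBond (F.P K) 0 → Matrix n n ℂ)) {A' : PBond (F.P K) 0 → Matrix n n ℂ} (hA : ∀ j, (A' j)ᴴ = -A' j)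
    (hW : ∀ j, (W A' j)ᴴ = -(W A' j))
    (h128 : ∀ δ : PBond (F.P K) 0 → Matrix n n ℂ, (∀ j, (δ j)ᴴ = -δ j) → (∀ c : PBond (F.P K) k, bondAvgIter k δ c = 0) →
      ∑ j, ((δ j)ᴴ * (DV A' j + W A' j)).trace.re = 0) :
    (A' - HV (QV A')) + GV (W ((A' - HV (QV A')) + HV (QV A'))) = 0 :=
  eq158_flatOps_oneLevel (succ_le_m_add_K F K k hk1) hc hw hDV hGV hQV hHV W hA hW h128

end Summit.QuantumFields.YangMills.Theorems.K0Stub1OneLevelConstraintDictionary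

end
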